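import Literature.AlgebraicGeometry.ModuliOfAbelianVarieties.Lan2013.Sec63Defs

/-!
# [Lan2013PELCompactifications] §6.3 vocabulary — proved companion of `Lan2013/Sec63Defs` (theorems only; RULING TS-1)

Topic `AlgebraicGeometry/ModuliOfAbelianVarieties/Lan2013`; namespace `Literature.AlgebraicGeometry.ModuliOfAbelianVarieties.Lan2013.Sec63Defs`
(squad TS, block R12, typer TS-t20).  PROOFS ONLY — no new definition, no named fact, no `sorry`, no axiom, no instance, no notation.
`multiRankGT_isStrictOrder` proves the sentence «These relations define a partial order on the set of all possible `𝒪`-multi-ranks» of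
Definition 6.3.3.8 (p. 429; 2010 rev. p. 480) for the REAL relation `Sec63Defs.MultiRankGT` (`r > r'` iff `|r| > |r'|` and `r_{[τ]} ≥ r'_{[τ]}`
for every `[τ]`): `>` is irreflexive and transitive, i.e. a strict partial order (Mathlib `IsStrictOrder`); `multiRankGT_asymm` records
asymmetry.  HC_CM is proved only modulo the 7 printed citations (2 remaining: hLiu418 = stmt-HodgeConjecture-24832, h413 =
stmt-HodgeConjecture-24833) until rung 0 closes; this file discharges no named fact (net debt 0).

## References
* [Lan2013PELCompactifications] K.-W. Lan, *Arithmetic compactifications of PEL-type Shimura varieties*, LMS Monographs 36 (2013),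
  Def. 6.3.3.8 (p. 429); 2010 revision p. 480.
-/

namespace Literature.AlgebraicGeometry.ModuliOfAbelianVarieties.Lan2013.Sec63Defs

universe v

/-- **Definition 6.3.3.8, last sentence** (p. 429): «These relations define a partial order on the set of all possible `𝒪`-multi-ranks.» —
the relation `r > r'` (`Sec63Defs.MultiRankGT`: `|r| > |r'|` and `r_{[τ]} ≥ r'_{[τ]}` for all `[τ]`) is a strict partial order:
irreflexive since `|r| > |r|` fails, transitive since both clauses are. [cite: Lan2013PELCompactifications, Def. 6.3.3.8 (p. 429)] -/
theorem multiRankGT_isStrictOrder (ι : Type v) : IsStrictOrder (ι → ℕ) MultiRankGT where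
  irrefl _ h := lt_irrefl _ h.1
  trans _ _ _ h₁ h₂ := ⟨lt_trans h₂.1 h₁.1, fun τ => le_trans (h₂.2 τ) (h₁.2 τ)⟩

/-- Asymmetry of `>` on `𝒪`-multi-ranks («We say `r` is smaller than `r'`, denoted `r < r'`, if `r' > r`» — never both).
[cite: Lan2013PELCompactifications, Def. 6.3.3.8 (p. 429)] -/
theorem multiRankGT_asymm {ι : Type v} {r r' : ι → ℕ} (h : MultiRankGT r r') : ¬ MultiRankGT r' r :=
  fun h' => lt_irrefl _ (lt_trans h.1 h'.1)

end Literature.AlgebraicGeometry.ModuliOfAbelianVarieties.Lan2013.Sec63Defs
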